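import Summits.Ventures.HodgeRepro.Night3FaceClosureTwist
import Summits.Ventures.HodgeRepro.Night3CensusBridge

/-!
# «S4 on the census representatives ⟹ S4», generic over the sealer's engine (kernel)

Blind re-derivation cell `pub-hodge-repro`, seat `night-3` (gen 3).  Imports night-3's twist reduction
(`Night3FaceClosureTwist`: `alg_of_faces_gset_reps`) and the engine ↔ model bridge (`Night3CensusBridge`:
`coversFaces`, the transport `cover_of_coversFaces`).  Namespace `HodgeRepro.Night3.Census`.

`alg_of_reps` reads: for any Cayley table `Γ` (a group with central involution `conj`) and any list `reps` of faces with
`coversFaces Γ reps = true` (every face a Galois twist of a member of `reps` — decided per sealed row in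
`Night3CensusCover8` / `Night3CensusCover12a` / `Night3CensusCover12b`), a predicate `Alg` on multisets of CM types of
`(Elt Γ, conj Γ)` with `hadd` / `hcancel` (Lemma P), `hpair` (Lefschetz (1,1) on the conjugate pairs), `htwist` (Galois
twists preserve `Alg`) and `hreps` — `Alg` on the corner multisets of the representatives — holds on every zero-sum
multiset: S4 on the representatives ⟹ S4 for every corner product.  The eleven sealed instances are in
`Night3CensusS4Rows`.  Nothing here closes S4; no sealed file is touched; no Tier-2 item depends on this file.
-/

set_option autoImplicit false

namespace HodgeRepro.Night3.Census

open Summit.Ventures.HodgeRepro.FaceCensus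
open HodgeRepro.EngineBridge
open HodgeRepro.Night3.GSet
open scoped Pointwise

variable {n : ℕ}

/-- **«S4 on the representatives ⟹ S4», generic**: for a Cayley table `Γ` (a group with central involution `conj`) and a
list `reps` of faces with `coversFaces Γ reps = true`, a predicate `Alg` with `hadd` / `hcancel` / `hpair` / `htwist` and
`hreps` (`Alg` on the corner multisets of the representatives) holds on every zero-sum multiset of CM types. -/
theorem alg_of_reps (Γ : CMGaloisType n) [Fact (Γ.isCMGaloisType = true)] (reps : List (ℕ × ℕ × ℕ))
    (hcov : coversFaces Γ reps = true) (Alg : Multiset (Finset (Elt Γ)) → Prop)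
    (hadd : ∀ M N, IsZeroSumG (Elt.conj Γ) M → IsZeroSumG (Elt.conj Γ) N → Alg M → Alg N → Alg (M + N))
    (hcancel : ∀ M N, IsZeroSumG (Elt.conj Γ) M → IsZeroSumG (Elt.conj Γ) N → Alg (M + N) → Alg N → Alg M)
    (hpair : ∀ Φ, IsCMType (Elt.conj Γ) Φ → Alg {Φ, Elt.conj Γ • Φ})
    (htwist : ∀ M g, Alg M → Alg (twistMul M g))
    (hreps : ∀ r ∈ reps, Alg (cornersMul Γ r))
    (M : Multiset (Finset (Elt Γ))) (hM : IsZeroSumG (Elt.conj Γ) M) : Alg M :=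
  alg_of_faces_gset_reps (Elt.isComplexConj_conj Γ) Alg hadd hcancel hpair htwist
    (reps.map (cornersMul Γ)).toFinset
    (fun N hN => by
      obtain ⟨r, hr, rfl⟩ := List.mem_map.1 (List.mem_toFinset.1 hN)
      exact hreps r hr)
    (fun Φ p p' hΦ hp => by
      obtain ⟨r, hr, g, e⟩ := cover_of_coversFaces Γ reps hcov Φ p p' hΦ hp
      exact ⟨cornersMul Γ r, List.mem_toFinset.2 (List.mem_map_of_mem hr), g, e⟩)
    M hM

end HodgeRepro.Night3.Census
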